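import Summits.CriticalPhenomena.PercolationContinuityZ3.Theorems.PercNearOneGluingNoHeavyQuantThetaPivotalPerimeter
import Literature.Probability.Percolation.LongRangeVolumeTailBootstrap
import HarnessLib

/-!
# QUANT lane (p4 gen 18): the Aizenman–Barsky (1.13) / Grimmett (5.51) / Durrett (5) mechanism AT FIXED VOLUME —
# the pivotal edges of `{|C(o)| ≥ n}`, per edge, on any countable graph

builds on p205010 (kernel theorem, internal audit signed; external expert review pending) — NOT used in this file.

Aizenman–Barsky's second differential inequality `∂M/∂p ≤ 2d·M·∂M/∂γ·(1−γ)/(1−p)` (AB87 (1.13); Grimmett 1999 Lemma (5.51);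
for `γ = 0` Durrett 1985 eq. (5), `θ' ≤ θ·E[|∂_E C|; |C| < ∞]/(1−p)`) is proved in print by conditioning on the cluster of the
origin when it misses the green set and opening a CLOSED BOUNDARY EDGE towards a vertex joined to a green site off that
cluster.  The ghost field only randomises the VOLUME THRESHOLD; this file runs the same mechanism for the fixed-threshold event
`A_n = {|C(o)| ≥ n}` (`clusterSizeGe o n`, an increasing event), per edge, on an arbitrary countable graph — the `γ`-free,
`n`-resolved form of (5.51):

* `exists_clusterIs_of_isPivotal_clusterSizeGe` — **if `e = ab` is pivotal for `{|C(o)| ≥ n}` in `ω`** then the cluster `S`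
  of `o` in `ω ∖ e` has `|S| < n` vertices, contains exactly one endpoint of `e`, and the other endpoint has at least
  `n − |S|` vertices in its cluster of the configuration restricted to the pairs OFF `S`;
* `le_measure_isPivotal_clusterSizeGe` — conversely every configuration whose `o`-cluster off `e` has exactly `n − 1` vertices
  and exactly one endpoint of `e` makes `e` pivotal: **`Σ_{|S| = n−1, e ∈ ∂S} P_p(K_o = S) ≤ (1−p)·P_p(e pivotal for A_n)`**;
* `measure_isPivotal_clusterSizeGe_le` — **`(1−p)·P_p(e pivotal for A_n) ≤ Σ_{S ∋ a, S ∌ b, |S| < n} P_p(K_o = S)·P_p(|C(b)| ≥ n−|S|)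
  + (a ↔ b)`** (independence of `{ω ∖ e ∈ {K_o = S}}` from the configuration off `S`, and monotonicity in the domain).

Summed over the edges of `ℤ^d` against Russo's formula (sequel file `…QuantVolumeTailPerimeterZd`):
`E_p[|∂_E C|; |C| = n−1] ≤ (1−p)·d/dp P_p(|C| ≥ n) ≤ Σ_{m<n} E_p[|∂_E C|; |C| = m]·P_p(|C| ≥ n−m) ≤ 2d·E_p[|C|; |C| < n]`,
at EVERY `p ∈ (0,1)` including `p_c`; weighting by `γ(1−γ)^{n−1}` and summing over `n` returns (5.51).

HONEST: the printed AB87/Grimmett/Durrett mechanism written at fixed volume threshold (bookkeeping; the fixed-`n` statements were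
not found verbatim in print); a tool, no rate at `p_c`.

## References
* M. Aizenman, D. J. Barsky, Comm. Math. Phys. 108 (1987) 489–526, (1.13), Lemma 3.1 [AizenmanBarsky1987].
* G. Grimmett, *Percolation*, 2nd ed. (1999), Lemma (5.51) and its proof pp. 106–107, Thm (2.25) [GrimmettPercolation1999].
* R. Durrett, Z. Wahrsch. verw. Gebiete 69 (1985) 421–437, p. 435 eq. (5) [Durrett1985].
-/

noncomputable section

namespace Summit.CriticalPhenomena.PercolationContinuityZ3.Theorems.VolumePerimeter

open MeasureTheory Literature.Probability.Percolation Literature.Probability.LatticeModels ThetaPerimeter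
open scoped ENNReal

variable {V : Type*}

/-! ### §1 Combinatorics: one added edge and the volume threshold -/

/-- Core of the decomposition: if the cluster of `o` in `η` has fewer than `n` vertices and contains `x`, while the
cluster of `o` in `insert s(x,y) η` has at least `n` vertices, then `y` is outside the finite cluster `C` and
`n ≤ |C| + |C^{off C}(y)|`, where `C^{off C}(y)` is the cluster of `y` among the pairs avoiding `C`. -/
theorem notMem_and_le_of_insert {η : BondConfig V} {o x y : V} {n : ℕ}
    (hsmall : (openCluster η o).encard < n) (hbig : (n : ℕ∞) ≤ (openCluster (insert s(x, y) η) o).encard)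
    (hx : x ∈ openCluster η o) :
    y ∉ openCluster η o ∧
      (n : ℕ∞) ≤ (openCluster η o).encard + (openCluster (η ∩ ((openCluster η o)ᶜ).sym2) y).encard := by
  have hcases := fun z (hz : z ∈ openCluster (insert s(x, y) η) o) => reachable_insert_cases η o x y z hz
  have hxa : ∀ w, w ∈ openCluster η x → w ∈ openCluster η o := fun w hw => SimpleGraph.Reachable.trans hx hw
  -- `C⁺ ⊆ C⁻ ∪ C_η(y)`
  have hsub : openCluster (insert s(x, y) η) o ⊆ openCluster η o ∪ openCluster η y := by
    intro w hw
    rcases hcases w hw with h1 | ⟨_, h2 | h2⟩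
    · exact Or.inl h1
    · exact Or.inl (hxa w h2)
    · exact Or.inr h2
  have hy : y ∉ openCluster η o := by
    intro hyo
    have hsub' : openCluster (insert s(x, y) η) o ⊆ openCluster η o := by
      intro w hw
      rcases hsub hw with h1 | h2
      · exact h1
      · exact SimpleGraph.Reachable.trans hyo h2
    exact absurd (hbig.trans (Set.encard_le_encard hsub')) (not_le.2 hsmall)
  refine ⟨hy, ?_⟩
  -- `C_η(y)` avoids `C⁻`, so it is a cluster of the restricted configuration
  have hdisj : ∀ w, w ∈ openCluster η y → w ∉ openCluster η o := by
    intro w hw hwo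
    exact hy (SimpleGraph.Reachable.trans hwo (SimpleGraph.Reachable.symm hw))
  have hsub2 : openCluster η y ⊆ openCluster (η ∩ ((openCluster η o)ᶜ).sym2) y :=
    fun w hw => reachable_inter_sym2_compl hdisj hw
  calc (n : ℕ∞) ≤ (openCluster (insert s(x, y) η) o).encard := hbig
    _ ≤ (openCluster η o ∪ openCluster η y).encard := Set.encard_le_encard hsub
    _ ≤ (openCluster η o).encard + (openCluster η y).encard := Set.encard_union_le _ _
    _ ≤ (openCluster η o).encard + (openCluster (η ∩ ((openCluster η o)ᶜ).sym2) y).encard := by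
        gcongr 1
        exact Set.encard_le_encard hsub2

/-- `↑(n - k) ≤ X` in `ℕ∞` from `↑n ≤ ↑k + X`. -/
theorem natCast_sub_le_of_le_add {n k : ℕ} {X : ℕ∞} (h : (n : ℕ∞) ≤ (k : ℕ∞) + X) : ((n - k : ℕ) : ℕ∞) ≤ X := by
  rw [ENat.coe_sub]
  exact tsub_le_iff_right.2 (by rwa [add_comm])

/-- **If `e = ab` is pivotal for `{|C(o)| ≥ n}` in `ω`**, then the cluster `S` of `o` in `ω ∖ e` has `|S| < n` vertices,
contains exactly one endpoint of `e`, and the other endpoint has at least `n − |S|` vertices in its cluster of the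
configuration restricted to the pairs off `S` (which does not contain `e`). -/
theorem exists_clusterIs_of_isPivotal_clusterSizeGe {o a b : V} {n : ℕ} {ω : BondConfig V}
    (h : IsPivotal (clusterSizeGe o n) s(a, b) ω) :
    ∃ S : Finset V, S.card < n ∧ ω \ {s(a, b)} ∈ clusterIs o S ∧
      ((a ∈ S ∧ b ∉ S ∧ ((n - S.card : ℕ) : ℕ∞) ≤ (openCluster (ω ∩ ((↑S : Set V)ᶜ).sym2) b).encard) ∨
       (b ∈ S ∧ a ∉ S ∧ ((n - S.card : ℕ) : ℕ∞) ≤ (openCluster (ω ∩ ((↑S : Set V)ᶜ).sym2) a).encard)) := by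
  classical
  rw [isPivotal_iff_of_isUpperSet (isUpperSet_clusterSizeGe o n)] at h
  obtain ⟨hplus, hminus⟩ := h
  set η : BondConfig V := ω \ {s(a, b)} with hη
  have hsmall : (openCluster η o).encard < n := by
    rw [mem_clusterSizeGe, not_le] at hminus; exact hminus
  have hfin : (openCluster η o).Finite := by
    rw [← Set.encard_lt_top_iff]; exact lt_of_lt_of_le hsmall le_top
  have hins : insert s(a, b) ω = insert s(a, b) η := by rw [hη, Set.insert_sdiff_singleton]
  rw [hins] at hplus
  have hbig : (n : ℕ∞) ≤ (openCluster (insert s(a, b) η) o).encard := hplus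
  set S : Finset V := hfin.toFinset with hS
  have hSc : (↑S : Set V) = openCluster η o := by rw [hS, Set.Finite.coe_toFinset]
  have hcl : η ∈ clusterIs o S := by rw [mem_clusterIs, hSc]
  have hcard : (S.card : ℕ∞) = (openCluster η o).encard := by
    rw [← hSc, Set.encard_coe_eq_coe_finsetCard]
  have hSn : S.card < n := by
    have := hsmall; rw [← hcard] at this; exact_mod_cast this
  refine ⟨S, hSn, hcl, ?_⟩
  -- restriction: `η ∩ (Sᶜ)² = ω ∩ (Sᶜ)²` because `e ∉ (Sᶜ)²` as soon as one endpoint lies in `S`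
  have hrestr : s(a, b) ∉ ((↑S : Set V)ᶜ).sym2 → η ∩ ((↑S : Set V)ᶜ).sym2 = ω ∩ ((↑S : Set V)ᶜ).sym2 := by
    intro he
    ext f
    simp only [hη, Set.mem_inter_iff, Set.mem_sdiff, Set.mem_singleton_iff]
    constructor
    · rintro ⟨⟨hf, _⟩, hK⟩; exact ⟨hf, hK⟩
    · rintro ⟨hf, hK⟩
      exact ⟨⟨hf, fun hfe => he (hfe ▸ hK)⟩, hK⟩
  -- one endpoint is in the finite cluster (else `C⁺ = C⁻`)
  have hab : a ∈ openCluster η o ∨ b ∈ openCluster η o := by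
    by_contra hcon
    push Not at hcon
    have hsub : openCluster (insert s(a, b) η) o ⊆ openCluster η o := by
      intro z hz
      rcases reachable_insert_cases η o a b z hz with h1 | ⟨h2, _⟩
      · exact h1
      · rcases h2 with h2 | h2
        · exact absurd h2 hcon.1
        · exact absurd h2 hcon.2
    exact absurd (hbig.trans (Set.encard_le_encard hsub)) (not_le.2 hsmall)
  rcases hab with ha | hb
  · obtain ⟨hbn, hle⟩ := notMem_and_le_of_insert hsmall hbig ha
    left
    refine ⟨by rw [← Finset.mem_coe, hSc]; exact ha, by rw [← Finset.mem_coe, hSc]; exact hbn, ?_⟩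
    have he : s(a, b) ∉ ((↑S : Set V)ᶜ).sym2 := fun hK =>
      (Set.mk_mem_sym2_iff.1 hK).1 (by rw [hSc]; exact ha)
    rw [← hrestr he, hSc]
    rw [← hcard] at hle
    exact natCast_sub_le_of_le_add hle
  · have hbig' : (n : ℕ∞) ≤ (openCluster (insert s(b, a) η) o).encard := by rw [Sym2.eq_swap]; exact hbig
    obtain ⟨han, hle⟩ := notMem_and_le_of_insert hsmall hbig' hb
    right
    refine ⟨by rw [← Finset.mem_coe, hSc]; exact hb, by rw [← Finset.mem_coe, hSc]; exact han, ?_⟩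
    have he : s(a, b) ∉ ((↑S : Set V)ᶜ).sym2 := fun hK =>
      (Set.mk_mem_sym2_iff.1 hK).2 (by rw [hSc]; exact hb)
    rw [← hrestr he, hSc]
    rw [← hcard] at hle
    exact natCast_sub_le_of_le_add hle

/-- **Converse at volume `n − 1`**: if the cluster of `o` in `ω ∖ e` is `S` with `|S| + 1 = n`, `x ∈ S`, `y ∉ S`, then
`e = xy` is pivotal for `{|C(o)| ≥ n}` (opening `e` adds at least the vertex `y`). -/
theorem isPivotal_clusterSizeGe_of_clusterIs {o x y : V} {n : ℕ} {ω : BondConfig V} {S : Finset V}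
    (hcl : ω \ {s(x, y)} ∈ clusterIs o S) (hx : x ∈ S) (hy : y ∉ S) (hn : S.card + 1 = n) :
    IsPivotal (clusterSizeGe o n) s(x, y) ω := by
  classical
  rw [isPivotal_iff_of_isUpperSet (isUpperSet_clusterSizeGe o n)]
  set η : BondConfig V := ω \ {s(x, y)} with hη
  rw [mem_clusterIs] at hcl
  have hxy : x ≠ y := fun h => hy (h ▸ hx)
  constructor
  · -- `insert e ω ⊇ insert e η`, whose `o`-cluster contains `S ∪ {y}`
    rw [mem_clusterSizeGe]
    have hins : insert s(x, y) ω = insert s(x, y) η := by rw [hη, Set.insert_sdiff_singleton]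
    rw [hins]
    have hxC : x ∈ openCluster (insert s(x, y) η) o :=
      openCluster_mono (Set.subset_insert _ _) o (by rw [hcl]; exact_mod_cast hx)
    have hyC : y ∈ openCluster (insert s(x, y) η) o :=
      SimpleGraph.Reachable.trans hxC
        ((openGraph_adj _ x y).2 ⟨Set.mem_insert _ _, hxy⟩).reachable
    have hsub : insert y (↑S : Set V) ⊆ openCluster (insert s(x, y) η) o := by
      intro z hz
      rcases Set.mem_insert_iff.1 hz with rfl | hz
      · exact hyC
      · exact openCluster_mono (Set.subset_insert _ _) o (by rw [hcl]; exact hz)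
    calc (n : ℕ∞) = (insert y (↑S : Set V)).encard := by
          rw [Set.encard_insert_of_notMem (by exact_mod_cast hy), Set.encard_coe_eq_coe_finsetCard, ← hn]; push_cast; rfl
      _ ≤ _ := Set.encard_le_encard hsub
  · rw [mem_clusterSizeGe, not_le, hcl, Set.encard_coe_eq_coe_finsetCard, ← hn]
    exact_mod_cast Nat.lt_succ_self _

/-! ### §2 Probability, per edge (any countable graph) -/

/-- The event "`y` has at least `k` vertices in its cluster among the pairs off `S`" is determined by the pairs off `S`. -/
theorem determinedBy_offSizeGe (S : Set V) (y : V) (k : ℕ) :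
    DeterminedBy {ω : BondConfig V | (k : ℕ∞) ≤ (openCluster (ω ∩ Sᶜ.sym2) y).encard} (Sᶜ.sym2) := by
  rw [determinedBy_iff]
  intro ω ω' h
  simp only [Set.mem_setOf_eq, h]

section Prob

variable [Countable V] (G : SimpleGraph V) (p : unitInterval)

/-- The off-`S` volume event is measurable. -/
theorem measurableSet_offSizeGe (S : Set V) (y : V) (k : ℕ) :
    MeasurableSet {ω : BondConfig V | (k : ℕ∞) ≤ (openCluster (ω ∩ Sᶜ.sym2) y).encard} :=
  (measurableSet_clusterSizeGe y k).preimage (measurable_inter_const _)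

omit [Countable V] in
/-- Monotonicity in the domain: `P(|C^{off S}(y)| ≥ k) ≤ P(|C(y)| ≥ k)`. -/
theorem measure_offSizeGe_le (S : Set V) (y : V) (k : ℕ) :
    bondPercolation G p {ω : BondConfig V | (k : ℕ∞) ≤ (openCluster (ω ∩ Sᶜ.sym2) y).encard} ≤
      bondPercolation G p (clusterSizeGe y k) :=
  measure_mono fun ω hω => le_trans (b := (openCluster (ω ∩ Sᶜ.sym2) y).encard) hω
    (Set.encard_le_encard (openCluster_mono Set.inter_subset_left y))

/-- `{ω | IsPivotal (clusterSizeGe o n) e ω}` is measurable. -/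
theorem measurableSet_isPivotal_clusterSizeGe (o : V) (n : ℕ) (e : Sym2 V) :
    MeasurableSet {ω : BondConfig V | IsPivotal (clusterSizeGe o n) e ω} := by
  have h1 : MeasurableSet {ω : BondConfig V | insert e ω ∈ clusterSizeGe o n} := by
    have hm : Measurable fun ω : BondConfig V => insert e ω := by
      exact measurable_set_iff.2 fun f => by
        simp only [Set.mem_insert_iff]
        exact measurable_const.or (measurable_set_mem f)
    exact (measurableSet_clusterSizeGe o n).preimage hm
  have h2 : MeasurableSet {ω : BondConfig V | ω \ {e} ∈ clusterSizeGe o n} :=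
    measurableSet_sdiff_preimage (measurableSet_clusterSizeGe o n) e
  have hset : {ω : BondConfig V | IsPivotal (clusterSizeGe o n) e ω} =
      ({ω | insert e ω ∈ clusterSizeGe o n} ∩ {ω | ω \ {e} ∈ clusterSizeGe o n}ᶜ) ∪
        ({ω | ω \ {e} ∈ clusterSizeGe o n} ∩ {ω | insert e ω ∈ clusterSizeGe o n}ᶜ) := by
    ext ω
    simp only [IsPivotal, Xor, Set.mem_setOf_eq, Set.mem_union, Set.mem_inter_iff, Set.mem_compl_iff]
  rw [hset]
  exact (h1.inter h2.compl).union (h2.inter h1.compl)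

/-- **LOWER BOUND, per edge, any countable graph**: for an edge `e = ab` of `G` and `p < 1`,
`Σ_{S : (a ∈ S, b ∉ S) or (b ∈ S, a ∉ S), |S|+1 = n} P_p(K_o = S) / (1 − p) ≤ P_p(e pivotal for {|C(o)| ≥ n})`
(the configurations whose `o`-cluster off `e` is such an `S` are disjoint in `S` and make `e` pivotal;
`P(K_o = S) = (1−p)·P(ω ∖ e ∈ {K_o = S})`). -/
theorem le_measure_isPivotal_clusterSizeGe [DecidableEq V] (o : V) {a b : V} (he : s(a, b) ∈ G.edgeSet)
    (hp1 : (p : ℝ) < 1) (n : ℕ) :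
    (∑' S : Finset V, if ((a ∈ S ∧ b ∉ S) ∨ (b ∈ S ∧ a ∉ S)) ∧ S.card + 1 = n
        then bondPercolation G p (clusterIs o S) else 0) / ENNReal.ofReal (1 - p) ≤
      bondPercolation G p {ω | IsPivotal (clusterSizeGe o n) s(a, b) ω} := by
  set μ := bondPercolation G p with hμ
  set e : Sym2 V := s(a, b) with hedef
  have hq0 : ENNReal.ofReal (1 - (p : ℝ)) ≠ 0 := by
    rw [ENNReal.ofReal_ne_zero_iff]; linarith
  have hqtop : ENNReal.ofReal (1 - (p : ℝ)) ≠ ⊤ := ENNReal.ofReal_ne_top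
  -- the disjoint family
  set E : Finset V → Set (BondConfig V) := fun S =>
    {ω | (((a ∈ S ∧ b ∉ S) ∨ (b ∈ S ∧ a ∉ S)) ∧ S.card + 1 = n) ∧ ω \ {e} ∈ clusterIs o S} with hE
  have hEmeas : ∀ S, MeasurableSet (E S) := by
    intro S
    by_cases hS : ((a ∈ S ∧ b ∉ S) ∨ (b ∈ S ∧ a ∉ S)) ∧ S.card + 1 = n
    · have : E S = {ω | ω \ {e} ∈ clusterIs o S} := by ext ω; simp [hE, hS]
      rw [this]; exact measurableSet_sdiff_preimage (measurableSet_clusterIs o S) e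
    · have : E S = ∅ := by ext ω; simp [hE, hS]
      rw [this]; exact MeasurableSet.empty
  have hEdisj : Pairwise fun S T => Disjoint (E S) (E T) := by
    intro S T hST
    rw [Set.disjoint_left]
    rintro ω ⟨_, hS⟩ ⟨_, hT⟩
    exact Set.disjoint_left.1 (pairwise_disjoint_clusterIs o hST) hS hT
  have hEsub : (⋃ S, E S) ⊆ {ω | IsPivotal (clusterSizeGe o n) e ω} := by
    intro ω hω
    obtain ⟨S, ⟨hcond, hn⟩, hcl⟩ := Set.mem_iUnion.1 hω
    rcases hcond with ⟨ha, hb⟩ | ⟨hb, ha⟩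
    · exact isPivotal_clusterSizeGe_of_clusterIs hcl ha hb hn
    · have hcl' : ω \ {s(b, a)} ∈ clusterIs o S := by rw [Sym2.eq_swap]; exact hcl
      have := isPivotal_clusterSizeGe_of_clusterIs hcl' hb ha hn
      rw [Sym2.eq_swap] at this; exact this
  -- termwise identity `μ(E S) = 1[cond]·μ(K_o = S)/(1-p)`
  have hterm : ∀ S : Finset V, μ (E S) =
      (if ((a ∈ S ∧ b ∉ S) ∨ (b ∈ S ∧ a ∉ S)) ∧ S.card + 1 = n then μ (clusterIs o S) else 0)
        / ENNReal.ofReal (1 - p) := by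
    intro S
    by_cases hS : ((a ∈ S ∧ b ∉ S) ∨ (b ∈ S ∧ a ∉ S)) ∧ S.card + 1 = n
    · rw [if_pos hS]
      have : E S = {ω | ω \ {e} ∈ clusterIs o S} := by ext ω; simp [hE, hS]
      rw [this, ENNReal.eq_div_iff hq0 hqtop, mul_comm]
      rcases hS.1 with ⟨ha, hb⟩ | ⟨hb, ha⟩
      · exact (measure_clusterIs_eq_mul G p o S ha hb he).symm
      · have he' : s(b, a) ∈ G.edgeSet := by rw [Sym2.eq_swap]; exact he
        have h := (measure_clusterIs_eq_mul G p o S hb ha he').symm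
        rw [Sym2.eq_swap] at h; exact h
    · rw [if_neg hS, ENNReal.zero_div]
      have : E S = ∅ := by ext ω; simp [hE, hS]
      rw [this, measure_empty]
  calc (∑' S : Finset V, if ((a ∈ S ∧ b ∉ S) ∨ (b ∈ S ∧ a ∉ S)) ∧ S.card + 1 = n then μ (clusterIs o S) else 0)
          / ENNReal.ofReal (1 - p)
      = ∑' S : Finset V, (if ((a ∈ S ∧ b ∉ S) ∨ (b ∈ S ∧ a ∉ S)) ∧ S.card + 1 = n then μ (clusterIs o S) else 0)
          / ENNReal.ofReal (1 - p) := by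
        simp only [div_eq_mul_inv, ENNReal.tsum_mul_right]
    _ = ∑' S, μ (E S) := tsum_congr fun S => (hterm S).symm
    _ = μ (⋃ S, E S) := (measure_iUnion hEdisj hEmeas).symm
    _ ≤ μ {ω | IsPivotal (clusterSizeGe o n) e ω} := measure_mono hEsub

/-- **UPPER BOUND, per edge, any countable graph** (the AB87 (1.13)/Grimmett (5.51) mechanism at fixed volume): for an edge
`e = ab` of `G` and `p < 1`,
`P_p(e pivotal for {|C(o)| ≥ n}) ≤ (1/(1−p)) · [Σ_{S ∋ a, S ∌ b, |S| < n} P_p(K_o = S)·P_p(|C(b)| ≥ n − |S|) + (a ↔ b)]`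
(independence of `{ω ∖ e ∈ {K_o = S}}` — determined by the pairs touching `S` — from the off-`S` volume event, then
`P(|C^{off S}(b)| ≥ k) ≤ P(|C(b)| ≥ k)`). -/
theorem measure_isPivotal_clusterSizeGe_le [DecidableEq V] (o : V) {a b : V} (he : s(a, b) ∈ G.edgeSet)
    (hp1 : (p : ℝ) < 1) (n : ℕ) :
    bondPercolation G p {ω | IsPivotal (clusterSizeGe o n) s(a, b) ω}
      ≤ ((∑' S : Finset V, if a ∈ S ∧ b ∉ S ∧ S.card < n
            then bondPercolation G p (clusterIs o S) * bondPercolation G p (clusterSizeGe b (n - S.card)) else 0)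
          + (∑' S : Finset V, if b ∈ S ∧ a ∉ S ∧ S.card < n
            then bondPercolation G p (clusterIs o S) * bondPercolation G p (clusterSizeGe a (n - S.card)) else 0))
        / ENNReal.ofReal (1 - p) := by
  set μ := bondPercolation G p with hμ
  set e : Sym2 V := s(a, b) with hedef
  have hq0 : ENNReal.ofReal (1 - (p : ℝ)) ≠ 0 := by
    rw [ENNReal.ofReal_ne_zero_iff]; linarith
  have hqtop : ENNReal.ofReal (1 - (p : ℝ)) ≠ ⊤ := ENNReal.ofReal_ne_top
  -- the two families of events
  set E1 : Finset V → Set (BondConfig V) := fun S =>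
    {ω | (a ∈ S ∧ b ∉ S ∧ S.card < n) ∧ ω \ {e} ∈ clusterIs o S ∧
      ((n - S.card : ℕ) : ℕ∞) ≤ (openCluster (ω ∩ ((↑S : Set V)ᶜ).sym2) b).encard} with hE1
  set E2 : Finset V → Set (BondConfig V) := fun S =>
    {ω | (b ∈ S ∧ a ∉ S ∧ S.card < n) ∧ ω \ {e} ∈ clusterIs o S ∧
      ((n - S.card : ℕ) : ℕ∞) ≤ (openCluster (ω ∩ ((↑S : Set V)ᶜ).sym2) a).encard} with hE2
  have hcover : {ω | IsPivotal (clusterSizeGe o n) e ω} ⊆ ⋃ S : Finset V, (E1 S ∪ E2 S) := by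
    intro ω hω
    obtain ⟨S, hSn, hcl, h⟩ := exists_clusterIs_of_isPivotal_clusterSizeGe hω
    refine Set.mem_iUnion.2 ⟨S, ?_⟩
    rcases h with ⟨h1, h2, h3⟩ | ⟨h1, h2, h3⟩
    · exact Or.inl ⟨⟨h1, h2, hSn⟩, hcl, h3⟩
    · exact Or.inr ⟨⟨h1, h2, hSn⟩, hcl, h3⟩
  -- termwise bounds
  have hterm : ∀ (x y : V) (S : Finset V), s(x, y) = e →
      μ {ω | (x ∈ S ∧ y ∉ S ∧ S.card < n) ∧ ω \ {e} ∈ clusterIs o S ∧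
            ((n - S.card : ℕ) : ℕ∞) ≤ (openCluster (ω ∩ ((↑S : Set V)ᶜ).sym2) y).encard}
        ≤ (if x ∈ S ∧ y ∉ S ∧ S.card < n then μ (clusterIs o S) * μ (clusterSizeGe y (n - S.card)) else 0)
            / ENNReal.ofReal (1 - p) := by
    intro x y S hxy
    by_cases hS : x ∈ S ∧ y ∉ S ∧ S.card < n
    · rw [if_pos hS]
      have hset : {ω : BondConfig V | (x ∈ S ∧ y ∉ S ∧ S.card < n) ∧ ω \ {e} ∈ clusterIs o S ∧
            ((n - S.card : ℕ) : ℕ∞) ≤ (openCluster (ω ∩ ((↑S : Set V)ᶜ).sym2) y).encard}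
          = {ω | ω \ {e} ∈ clusterIs o S} ∩
              {ω | ((n - S.card : ℕ) : ℕ∞) ≤ (openCluster (ω ∩ ((↑S : Set V)ᶜ).sym2) y).encard} := by
        ext ω; simp [hS]
      rw [hset, bondPercolation_inter_of_disjoint G p (disjoint_edgesTouching_compl_sym2 (↑S : Set V))
        (determinedBy_sdiff_preimage (determinedBy_clusterIs o S) e) (determinedBy_offSizeGe _ y _)
        (measurableSet_sdiff_preimage (measurableSet_clusterIs o S) e) (measurableSet_offSizeGe _ y _)]
      have hA : μ {ω | ω \ {e} ∈ clusterIs o S} = μ (clusterIs o S) / ENNReal.ofReal (1 - p) := by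
        rw [ENNReal.eq_div_iff hq0 hqtop, mul_comm]
        exact (measure_clusterIs_eq_mul G p o S hS.1 hS.2.1 (hxy ▸ he) |>.trans (by rw [hxy])).symm
      have hoff := measure_offSizeGe_le G p (↑S : Set V) y (n - S.card)
      rw [hA]
      calc μ (clusterIs o S) / ENNReal.ofReal (1 - p) *
            μ {ω | ((n - S.card : ℕ) : ℕ∞) ≤ (openCluster (ω ∩ ((↑S : Set V)ᶜ).sym2) y).encard}
          ≤ μ (clusterIs o S) / ENNReal.ofReal (1 - p) * μ (clusterSizeGe y (n - S.card)) := by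
            gcongr
        _ = μ (clusterIs o S) * μ (clusterSizeGe y (n - S.card)) / ENNReal.ofReal (1 - p) := by
            rw [ENNReal.div_eq_inv_mul, ENNReal.div_eq_inv_mul, mul_assoc]
    · have hset : {ω : BondConfig V | (x ∈ S ∧ y ∉ S ∧ S.card < n) ∧ ω \ {e} ∈ clusterIs o S ∧
            ((n - S.card : ℕ) : ℕ∞) ≤ (openCluster (ω ∩ ((↑S : Set V)ᶜ).sym2) y).encard} = ∅ := by
        ext ω; simp [hS]
      rw [hset, measure_empty]; exact bot_le
  calc μ {ω | IsPivotal (clusterSizeGe o n) e ω}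
      ≤ μ (⋃ S : Finset V, (E1 S ∪ E2 S)) := measure_mono hcover
    _ ≤ ∑' S : Finset V, μ (E1 S ∪ E2 S) := measure_iUnion_le _
    _ ≤ ∑' S : Finset V, (μ (E1 S) + μ (E2 S)) := ENNReal.tsum_le_tsum fun S => measure_union_le _ _
    _ = (∑' S, μ (E1 S)) + ∑' S, μ (E2 S) := ENNReal.tsum_add
    _ ≤ (∑' S : Finset V, (if a ∈ S ∧ b ∉ S ∧ S.card < n
            then μ (clusterIs o S) * μ (clusterSizeGe b (n - S.card)) else 0) / ENNReal.ofReal (1 - p))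
        + ∑' S : Finset V, (if b ∈ S ∧ a ∉ S ∧ S.card < n
            then μ (clusterIs o S) * μ (clusterSizeGe a (n - S.card)) else 0) / ENNReal.ofReal (1 - p) := by
        gcongr with S S
        · exact hterm a b S rfl
        · exact hterm b a S Sym2.eq_swap
    _ = _ := by
        simp only [div_eq_mul_inv, ENNReal.tsum_mul_right]
        rw [← add_mul]

end Prob

end Summit.CriticalPhenomena.PercolationContinuityZ3.Theorems.VolumePerimeter

end
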